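import Literature.MathematicalPhysics.QuantumFieldTheory.Balaban1983to89.B9Ineq349WordDiffHom
import Literature.MathematicalPhysics.QuantumFieldTheory.Balaban1983to89.B9B8KnitLetterMajorantTransfer

/-!
# `Balaban1983to89.B9Ineq349WordDiffHomWeighted` — T. Bałaban, *Propagators for lattice gauge theories in a background field*, Commun. Math. Phys. **99** (1985)
# 389–434 [Balaban1985BackgroundPropagators], (3.42) p. 397, (3.106) p. 414, p. 398 (remark after (3.47)); [4] = *Propagators … II*, CMP **96** (1984), (2.50)–(2.52)
# p. 232, Lemma 2.1 (2.61) p. 234: p38's FILE 2a differenced end letters (`B9Ineq349WordDiffHom.hasMajorantHom_leftDiff ∕ _rightDiff`) FOR A LEVEL-WEIGHTED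
# block-diagonal middle letter `E ≺ θ_E·ℓ(a)⁻²·𝟙` — the shape the letter `η⁻²(Δ′_a(U; parSymY) − Δ′_a(U; parKnitY))` has on the LOCAL class (3.35) p. 396

statement-level skeleton of published theorems with citation tags; proofs where landed; nothing here is a claim about the Yang–Mills mass gap

WHY THIS FILE (cell `pub-ymgap`, node N06, seat `dag-n06-j` gen 36; generic two-space calculus for the chain «Thm 3.3's block at `parKnitY` on (3.35)»).  FILE 2a's
`leftDiff` ∕ `rightDiff` price `X₂∘E∘G₁` and `G₂∘E∘Y₁` for a CONSTANT block-diagonal `E ≺ θ_E𝟙` and spend `ℓ ≤ 1`.  On the local class (3.35) the junction's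
`E` carries the level weight `ℓ(a)⁻²` (`B9B8KnitLetterTransferReg335`); THIS FILE proves the same two conclusions for the weighted `E`: the weight cancels the `ℓ²`
of the neighbouring `G′`-letter at the same point (`E∘G₁ ≺ θ_EB₀·e^{−δd}` weight-free; `E∘Y₁ ≺ θ_EB_Y·ℓ⁻¹·e^{−δd}`, the middle weight `ℓ⁻¹` moved to the left point by
its scale transfer).

WHAT IS PROVED (sorry-free; 0 `def`; any `B9.Geometry`).  ★ `hasMajorantHom_leftDiff_w` (`X₂∘E∘G₁ ≺ (B_Xθ_EB₀Λc₁)·ℓ(a)·e^{−ρd}`, `Λ ≥ 1`, no transfer needed),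
★ `hasMajorantHom_rightDiff_w` (`G₂∘E∘Y₁ ≺ (B₀θ_EB_YΛc₁)·ℓ(a)·e^{−ρd}`, transfer of `ℓ⁻¹` at `(δ₀, α, Λ)`).
HONEST SCOPE.  Elementary majorant algebra ([4] (2.52) + (2.61)); helper, count-neutral; N06 NOT discharged; nothing continuum ∕ OS ∕ mass gap ∕ Clay — the
Yang–Mills mass gap is NOT proved here.  No `sorry`, no `axiom`, no `instance`, no `notation`, no `def`.  NEW file.
RELATED, NOT DUPLICATED (searched 2026-08-30: `rg -l -w "leftDiff_w|rightDiff_w|WordDiffHomWeighted"` over `lean/Literature` = ∅): FILE 2a (the constant-`E` originals).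
-/

noncomputable section

namespace Literature.MathematicalPhysics.QuantumFieldTheory.Balaban1983to89.B9Ineq349WordDiffHomWeighted

open B6RandomWalk (HasMajorant Triangle254 Ineq261 hasMajorant_mono c1_nonneg)
open B6RandomWalkHom (HasMajorantHom hasMajorantHom_mono hasMajorantHom_iff hasMajorantHom_comp)
open B9Thm34Ext (toB6)
open B9Ineq347 (ScaleTransfer)
open B9Ineq349Hom (hasMajorantHom_rate_mono hasMajorantHom_comp_decay)

section Generic

variable {g : B9.Geometry} [Fintype g.Site] [DecidableEq g.Site] {R : ℝ} {H : Prop} {X I : Type}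

/-- ★ **THE LEFT DIFFERENCED END LETTER, WEIGHTED `E`**: `X₂ ≺ B_Xℓe^{−δd}` (a left entry), `E ≺ θ_E·ℓ(a)⁻²·𝟙` (block-diagonal with the level weight of the local
class), `G₁ ≺ B₀ℓ²e^{−δd}`, `ℓ > 0`, the transfer of `1` at `α` being trivial, (2.61) at `β`, `ρ + (α+β)δ₀ ≤ δ` ⟹ `X₂∘E∘G₁ ≺ (B_Xθ_EB₀Λc₁)·ℓ(a)·e^{−ρd}` for any
`Λ ≥ 1` — FILE 2a's `hasMajorantHom_leftDiff` with `E∘G₁ ≺ θ_EB₀·e^{−δd}` weight-free (the weight of `E` cancels the `ℓ²` of `G₁` at the same point).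
[cite: Balaban1985BackgroundPropagators, (3.42) p.397, (3.106) p.414, (3.35) p.396; Balaban1984PropagatorsII, (2.50)–(2.52) p.232, Lemma 2.1 (2.61) p.234] -/
theorem hasMajorantHom_leftDiff_w (blkX : X → g.Site) (blkI : I → g.Site) (d : ℕ) (δ₀ δ α β ρ Λ BX θE B₀ : ℝ)
    (hBX : 0 ≤ BX) (hθE : 0 ≤ θE) (hB₀ : 0 ≤ B₀) (hΛ : 1 ≤ Λ) (hρ : 0 ≤ ρ) (hα : 0 ≤ α) (hβ : 0 ≤ β) (hδ₀ : 0 ≤ δ₀) (hr : ρ + (α + β) * δ₀ ≤ δ)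
    (hdnn : ∀ a b : g.Site, 0 ≤ g.dist a b) (htri : Triangle254 (toB6 g R H)) (hlen : ∀ a, 0 < g.len a)
    (h261 : Ineq261 d (toB6 g R H) δ₀ β)
    {X₂ : (X → ℝ) →ₗ[ℝ] (I → ℝ)} {E G₁ : Module.End ℝ (X → ℝ)}
    (hX₂ : HasMajorantHom (g := toB6 g R H) blkX blkI X₂ (fun a b => BX * g.len a * Real.exp (-(δ * g.dist a b))))
    (hE : HasMajorant (g := toB6 g R H) blkX E (fun a b : g.Site => if a = b then θE * (g.len a ^ 2)⁻¹ else 0))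
    (hG₁ : HasMajorant (g := toB6 g R H) blkX G₁ (fun a b => B₀ * g.len a ^ 2 * Real.exp (-(δ * g.dist a b)))) :
    HasMajorantHom (g := toB6 g R H) blkX blkI (X₂ ∘ₗ E ∘ₗ G₁) (fun a b => (BX * θE * B₀ * Λ * B6.c1 d δ₀ β) * g.len a * Real.exp (-(ρ * g.dist a b))) := by
  have hc0 : 0 ≤ B6.c1 d δ₀ β := c1_nonneg d δ₀ β
  have hΛ0 : 0 ≤ Λ := zero_le_one.trans hΛ
  have hw1 : ∀ a : g.Site, 0 ≤ g.len a := fun a => (hlen a).le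
  have hρδ : ρ ≤ δ := by
    have : 0 ≤ (α + β) * δ₀ := by positivity
    linarith
  have hE' : HasMajorantHom (g := toB6 g R H) blkX blkX E (fun a b : g.Site => if a = b then θE * (g.len a ^ 2)⁻¹ else 0) :=
    (hasMajorantHom_iff (g := toB6 g R H) blkX E _).mpr hE
  have hG₁' : HasMajorantHom (g := toB6 g R H) blkX blkX G₁ (fun a b => B₀ * g.len a ^ 2 * Real.exp (-(ρ * g.dist a b))) :=
    hasMajorantHom_rate_mono (R := R) (H := H) blkX blkX B₀ (fun a => g.len a ^ 2) hB₀ (fun a => sq_nonneg _) hρδ hdnn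
      ((hasMajorantHom_iff (g := toB6 g R H) blkX G₁ _).mpr hG₁)
  have hK : ∀ a b : g.Site, 0 ≤ B₀ * g.len a ^ 2 * Real.exp (-(ρ * g.dist a b)) := fun a b => by positivity
  -- `E∘G₁ ≺ θ_EB₀·e^{−ρd}`: the diagonal weight cancels the `ℓ²` at the same point
  have s1 : HasMajorantHom (g := toB6 g R H) blkX blkX (E ∘ₗ G₁) (fun a b => (θE * B₀) * 1 * Real.exp (-(ρ * g.dist a b))) := by
    refine hasMajorantHom_mono (g := toB6 g R H) blkX blkX (hasMajorantHom_comp (g := toB6 g R H) blkX blkX blkX hE' hG₁' hK) fun a b => le_of_eq ?_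
    have hl : g.len a ^ 2 ≠ 0 := pow_ne_zero 2 (hlen a).ne'
    have hsum := B9B8KnitLetterMajorantTransfer.sum_ite_eq_mul (S := g.Site) a (θE * (g.len a ^ 2)⁻¹)
      (fun y'' => B₀ * g.len y'' ^ 2 * Real.exp (-(ρ * g.dist y'' b)))
    refine hsum.trans ?_
    calc θE * (g.len a ^ 2)⁻¹ * (B₀ * g.len a ^ 2 * Real.exp (-(ρ * g.dist a b)))
        = θE * B₀ * ((g.len a ^ 2)⁻¹ * g.len a ^ 2) * Real.exp (-(ρ * g.dist a b)) := by ring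
      _ = θE * B₀ * 1 * Real.exp (-(ρ * g.dist a b)) := by rw [inv_mul_cancel₀ hl]
  -- the trivial transfer of the weight `1`
  have hT0 : ScaleTransfer g δ₀ α Λ (fun _ : g.Site => (1 : ℝ)) := fun a b => by
    have h1 : Real.exp (-(α * δ₀ * g.dist a b)) ≤ 1 := Real.exp_le_one_iff.2 (by nlinarith [hdnn a b, mul_nonneg hα hδ₀])
    linarith
  have s2 := hasMajorantHom_comp_decay (R := R) (H := H) blkX blkX blkI d δ₀ α β ρ δ Λ BX (θE * B₀) (fun a => g.len a) (fun _ => (1 : ℝ))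
    hw1 (fun _ => zero_le_one) hΛ0 hBX (mul_nonneg hθE hB₀) hρ hr hdnn htri hT0 h261 hX₂ s1
  refine hasMajorantHom_mono (g := toB6 g R H) blkX blkI s2 fun a b => le_of_eq ?_
  ring

/-- ★ **THE RIGHT DIFFERENCED END LETTER, WEIGHTED `E`**: `G₂ ≺ B₀ℓ²e^{−δd}`, `E ≺ θ_E·ℓ(a)⁻²·𝟙`, `Y₁ ≺ B_Yℓe^{−δd}` (a right entry), the transfer of `ℓ⁻¹`
at `(δ₀, α, Λ)`, (2.61) at `β`, `ρ + (α+β)δ₀ ≤ δ` ⟹ `G₂∘E∘Y₁ ≺ (B₀θ_EB_YΛc₁)·ℓ(a)·e^{−ρd}` — FILE 2a's `hasMajorantHom_rightDiff` with `E∘Y₁ ≺ θ_EB_Y·ℓ⁻¹·e^{−ρd}`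
(the weight of `E` against the `ℓ` of `Y₁`) and the middle weight `ℓ⁻¹` moved to the left point (`ℓ²·ℓ⁻¹ = ℓ`).
[cite: Balaban1985BackgroundPropagators, (3.42) p.397, (3.106) p.414, (3.35) p.396, p.398 (remark after (3.47)); Balaban1984PropagatorsII, (2.50)–(2.52) p.232, Lemma 2.1 (2.61) p.234] -/
theorem hasMajorantHom_rightDiff_w (blkI : I → g.Site) (blkX : X → g.Site) (d : ℕ) (δ₀ δ α β ρ Λ B₀ θE BY : ℝ)
    (hB₀ : 0 ≤ B₀) (hθE : 0 ≤ θE) (hBY : 0 ≤ BY) (hΛ : 0 ≤ Λ) (hρ : 0 ≤ ρ) (hα : 0 ≤ α) (hβ : 0 ≤ β) (hδ₀ : 0 ≤ δ₀) (hr : ρ + (α + β) * δ₀ ≤ δ)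
    (hdnn : ∀ a b : g.Site, 0 ≤ g.dist a b) (htri : Triangle254 (toB6 g R H)) (hlen : ∀ a, 0 < g.len a)
    (h261 : Ineq261 d (toB6 g R H) δ₀ β) (hT1i : ScaleTransfer g δ₀ α Λ (fun a => (g.len a)⁻¹))
    {G₂ E : Module.End ℝ (X → ℝ)} {Y₁ : (I → ℝ) →ₗ[ℝ] (X → ℝ)}
    (hG₂ : HasMajorant (g := toB6 g R H) blkX G₂ (fun a b => B₀ * g.len a ^ 2 * Real.exp (-(δ * g.dist a b))))
    (hE : HasMajorant (g := toB6 g R H) blkX E (fun a b : g.Site => if a = b then θE * (g.len a ^ 2)⁻¹ else 0))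
    (hY₁ : HasMajorantHom (g := toB6 g R H) blkI blkX Y₁ (fun a b => BY * g.len a * Real.exp (-(δ * g.dist a b)))) :
    HasMajorantHom (g := toB6 g R H) blkI blkX (G₂ ∘ₗ E ∘ₗ Y₁) (fun a b => (B₀ * θE * BY * Λ * B6.c1 d δ₀ β) * g.len a * Real.exp (-(ρ * g.dist a b))) := by
  have hc0 : 0 ≤ B6.c1 d δ₀ β := c1_nonneg d δ₀ β
  have hw1 : ∀ a : g.Site, 0 ≤ g.len a := fun a => (hlen a).le
  have hwi : ∀ a : g.Site, 0 ≤ (g.len a)⁻¹ := fun a => inv_nonneg.2 (hw1 a)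
  have hρδ : ρ ≤ δ := by
    have : 0 ≤ (α + β) * δ₀ := by positivity
    linarith
  have hE' : HasMajorantHom (g := toB6 g R H) blkX blkX E (fun a b : g.Site => if a = b then θE * (g.len a ^ 2)⁻¹ else 0) :=
    (hasMajorantHom_iff (g := toB6 g R H) blkX E _).mpr hE
  have hG₂' : HasMajorantHom (g := toB6 g R H) blkX blkX G₂ (fun a b => B₀ * g.len a ^ 2 * Real.exp (-(δ * g.dist a b))) :=
    (hasMajorantHom_iff (g := toB6 g R H) blkX G₂ _).mpr hG₂
  have hY₁' : HasMajorantHom (g := toB6 g R H) blkI blkX Y₁ (fun a b => BY * g.len a * Real.exp (-(ρ * g.dist a b))) :=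
    hasMajorantHom_rate_mono (R := R) (H := H) blkI blkX BY (fun a => g.len a) hBY hw1 hρδ hdnn hY₁
  have hK : ∀ a b : g.Site, 0 ≤ BY * g.len a * Real.exp (-(ρ * g.dist a b)) := fun a b => by have := hw1 a; positivity
  -- `E∘Y₁ ≺ θ_EB_Y·ℓ(a)⁻¹·e^{−ρd}`
  have s1 : HasMajorantHom (g := toB6 g R H) blkI blkX (E ∘ₗ Y₁) (fun a b => (θE * BY) * (g.len a)⁻¹ * Real.exp (-(ρ * g.dist a b))) := by
    refine hasMajorantHom_mono (g := toB6 g R H) blkI blkX (hasMajorantHom_comp (g := toB6 g R H) blkI blkX blkX hE' hY₁' hK) fun a b => le_of_eq ?_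
    have hl : g.len a ≠ 0 := (hlen a).ne'
    have hsum := B9B8KnitLetterMajorantTransfer.sum_ite_eq_mul (S := g.Site) a (θE * (g.len a ^ 2)⁻¹)
      (fun y'' => BY * g.len y'' * Real.exp (-(ρ * g.dist y'' b)))
    refine hsum.trans ?_
    have e2 : (g.len a ^ 2)⁻¹ * g.len a = (g.len a)⁻¹ := by
      rw [pow_two, mul_inv, mul_assoc, inv_mul_cancel₀ hl, mul_one]
    calc θE * (g.len a ^ 2)⁻¹ * (BY * g.len a * Real.exp (-(ρ * g.dist a b)))
        = θE * BY * ((g.len a ^ 2)⁻¹ * g.len a) * Real.exp (-(ρ * g.dist a b)) := by ring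
      _ = θE * BY * (g.len a)⁻¹ * Real.exp (-(ρ * g.dist a b)) := by rw [e2]
  -- `G₂∘(E∘Y₁)`: the middle weight `ℓ⁻¹` moves to the left point
  have s2 := hasMajorantHom_comp_decay (R := R) (H := H) blkI blkX blkX d δ₀ α β ρ δ Λ B₀ (θE * BY) (fun a => g.len a ^ 2) (fun a => (g.len a)⁻¹)
    (fun a => sq_nonneg _) hwi hΛ hB₀ (mul_nonneg hθE hBY) hρ hr hdnn htri hT1i h261 hG₂' s1
  refine hasMajorantHom_mono (g := toB6 g R H) blkI blkX s2 fun a b => le_of_eq ?_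
  have hl : g.len a ≠ 0 := (hlen a).ne'
  have e : g.len a ^ 2 * (g.len a)⁻¹ = g.len a := by rw [pow_two, mul_assoc, mul_inv_cancel₀ hl, mul_one]
  rw [e]
  ring

end Generic

end Literature.MathematicalPhysics.QuantumFieldTheory.Balaban1983to89.B9Ineq349WordDiffHomWeighted

end
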